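import Mathlib.RingTheory.Polynomial.Cyclotomic.Basic
import Mathlib.RingTheory.AdjoinRoot
import Literature.Computability.QuantumComplexity.PauliExpansion
import Literature.Computability.QuantumComplexity.RevTableau
import Literature.Computability.Cryptography.QuantumCircuit

/-!
# Route `SymplecticPurity` — route-posited objects for item `NoFreeFrame` (stmt-QuantumAdvantage-10731)

D-0016 `<Route>Defs` file. NOTHING IS ASSERTED here beyond two bookkeeping lemmas (wire bounds and
well-formedness of the witness program, needed to *type* the circuit). Objects:

* `puritySum k φ` — the 4-fold agreement sum of the route's items (`Tr ρ_{<k}²` on amplitudes,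
  verbatim the summand of `SymplecticPurityBound` / `NoFreeFrame`), `pauliExp S φ = ⟨φ|σ_S|φ⟩`,
  `cutSet N k = {wires < k}`;
* the WITNESS FAMILY of `NoFreeFrame` (the planner's `F_n`, made ancilla-free): on input length `n`
  with `n` ancillas, a Hadamard on every input wire, then the compiled (`revCompile`, Toffoli = exact
  Clifford+T word) reversible program `cubeOpsA n` writing the coordinates of `y ↦ y³` computed in
  `𝔽₂[X]/(X^{2h} + X^h + 1)`, `h = n / 2`, into the ancilla register WITHOUT scratch wires:
  `y³ = y · y²` and `y²` is `𝔽₂`-linear, so bit `l` of `y³` is the parity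
  `Σ_i y_i [l ∈ E(3i)] + Σ_{i ≠ j} y_i y_j [l ∈ E(i + 2j)]`, `E(m) = cubeExps h m` the exponents of
  `X^m mod (X^{2h} + X^h + 1)` (`X^{3h} = 1`, `X^{2h} = X^h + 1`); one `CNOT`/Toffoli per term
  (`cubeOpsA`, `cubeGates`, `cubeCirc`, `cubeFamily`);
* the good input lengths `n = 2·3^k`: `cubePoly k = Φ_{3^{k+1}} = X^{2·3^k} + X^{3^k} + 1 ∈ 𝔽₂[X]`,
  the ring `AdjoinRoot (cubePoly k)` (a field of order `2^{2·3^k}`, proved in the sequel files) and its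
  coordinate identification `cubeEquiv k : AdjoinRoot (cubePoly k) ≃+ (Fin (2·3^k) → ZMod 2)` in the
  power basis `1, α, …, α^{2·3^k − 1}` (the `e` of the route's `CubeGraphFlat`).

References: the route file `Theses/SymplecticPurity.lean` (items `NoFreeFrame`, `CubeGraphFlat`,
`SymplecticPurityBound`); R. Lidl, H. Niederreiter, *Finite Fields* (1997), Thm. 2.47(ii) and
Ex. 2.48 (irreducibility of `Φ_{3^{k+1}}` over `𝔽₂`); Nielsen–Chuang §4.3 (Toffoli in Clifford+T).
-/

noncomputable section

set_option linter.dupNamespace false -- D-0017: single-problem summit ⇒ `QuantumAdvantage.QuantumAdvantage` by design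

namespace Summit.QuantumAdvantage.QuantumAdvantage.Theorems.SymplecticPurity

open Literature.Computability.QuantumComplexity Literature.Computability.Cryptography

/-! ### Purity of a linear cut, Pauli expectations -/

variable {N : ℕ}

/-- The 4-fold agreement sum of the route files: `Tr ρ_A²` for `A = {wires < k}`, written on the
amplitudes of `φ` (for a unit vector; in general homogeneous of degree 4 in `φ`). -/
def puritySum (k : ℕ) (φ : QReg N → ℂ) : ℂ :=
  ∑ x₁ : QReg N, ∑ x₂ : QReg N, ∑ x₃ : QReg N, ∑ x₄ : QReg N,
    (if (∀ i, k ≤ i.val → x₁ i = x₂ i) ∧ (∀ i, i.val < k → x₂ i = x₃ i) ∧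
        (∀ i, k ≤ i.val → x₃ i = x₄ i) ∧ (∀ i, i.val < k → x₄ i = x₁ i) then
      φ x₁ * star (φ x₂) * φ x₃ * star (φ x₄) else 0)

/-- The (unnormalised) Pauli expectation `⟨φ|σ_S|φ⟩`. -/
def pauliExp (S : Fin N → Pauli) (φ : QReg N → ℂ) : ℂ :=
  star φ ⬝ᵥ (pauliString S).mulVec φ

/-- The wire set `{i : i < k}` of a linear cut. -/
def cutSet (N k : ℕ) : Finset (Fin N) := Finset.univ.filter fun i : Fin N => i.val < k

/-! ### The witness family -/

/-- The exponents of `X^m` reduced modulo `X^{2h} + X^h + 1` over `𝔽₂` (using `X^{3h} = 1` and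
`X^{2h} = X^h + 1`): `[m mod 3h]` if that is `< 2h`, else `[m mod 3h − h, m mod 3h − 2h]`; the empty
list in the degenerate case `h = 0` (input lengths `n ≤ 1`, never used). -/
def cubeExps (h m : ℕ) : List ℕ :=
  if h = 0 then [] else
    if m % (3 * h) < 2 * h then [m % (3 * h)] else [m % (3 * h) - h, m % (3 * h) - 2 * h]

/-- The linear part of the cube program on input length `n` (`h = n / 2`): one `CNOT` from input
wire `i` onto ancilla wire `n + l` for every `l ∈ cubeExps h (3i)` (the terms `y_i X^{3i}`). -/
def cubeLinOps (n : ℕ) : List (ClOp ℕ) :=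
  (List.range n).flatMap fun i => (cubeExps (n / 2) (3 * i)).map fun l => ClOp.cnot i (n + l)

/-- The quadratic part: one Toffoli with controls `i ≠ j` onto ancilla wire `n + l` for every
`l ∈ cubeExps h (i + 2j)` (the terms `y_i y_j X^{i + 2j}`). -/
def cubeQuadOps (n : ℕ) : List (ClOp ℕ) :=
  (List.range n).flatMap fun i => (List.range n).flatMap fun j =>
    if i = j then [] else (cubeExps (n / 2) (i + 2 * j)).map fun l => ClOp.toffoli i j (n + l)

/-- The cube program on `ℕ`-indexed wires: input register `0 … n-1`, ancilla register
`n … 2n-1`. -/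
def cubeOpsA (n : ℕ) : List (ClOp ℕ) := cubeLinOps n ++ cubeQuadOps n

/-- Every exponent produced by `cubeExps h m` is `< 2h`. -/
theorem lt_of_mem_cubeExps {h m l : ℕ} (hl : l ∈ cubeExps h m) : l < 2 * h := by
  unfold cubeExps at hl
  split_ifs at hl with hh hlt
  · simp at hl
  · rw [List.mem_singleton] at hl; omega
  · simp only [List.mem_cons, List.not_mem_nil, or_false] at hl
    have hpos : 0 < 3 * h := by omega
    have := Nat.mod_lt m hpos
    omega

/-- All wires of the cube program are `< n + n`. -/
theorem cubeOpsA_wires {n : ℕ} : ∀ op ∈ cubeOpsA n, ∀ i ∈ RevSim.wiresOf op, i < n + n := by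
  intro op hop i hi
  simp only [cubeOpsA, cubeLinOps, cubeQuadOps, List.mem_append, List.mem_flatMap, List.mem_map,
    List.mem_range] at hop
  rcases hop with ⟨a, ha, l, hl, rfl⟩ | ⟨a, ha, b, hb, hop⟩
  · have := lt_of_mem_cubeExps hl
    simp only [RevSim.mem_wiresOf, ClOp.target, ClOp.controls, List.mem_singleton] at hi
    omega
  · split_ifs at hop with hab
    · simp at hop
    · rw [List.mem_map] at hop
      obtain ⟨l, hl, rfl⟩ := hop
      have := lt_of_mem_cubeExps hl
      simp only [RevSim.mem_wiresOf, ClOp.target, ClOp.controls, List.mem_cons,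
        List.not_mem_nil, or_false] at hi
      omega

/-- The cube program is well formed (each gate acts on pairwise distinct wires). -/
theorem cubeOpsA_wf {n : ℕ} : ∀ op ∈ cubeOpsA n, op.WF := by
  intro op hop
  simp only [cubeOpsA, cubeLinOps, cubeQuadOps, List.mem_append, List.mem_flatMap, List.mem_map,
    List.mem_range] at hop
  rcases hop with ⟨a, ha, l, -, rfl⟩ | ⟨a, ha, b, hb, hop⟩
  · show a ≠ n + l; omega
  · split_ifs at hop with hab
    · simp at hop
    · rw [List.mem_map] at hop
      obtain ⟨l, -, rfl⟩ := hop
      show a ≠ b ∧ a ≠ n + l ∧ b ≠ n + l; omega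

/-- The cube program transported to `Fin (n + n)`-indexed wires (reduction mod `n + n`, the
identity on its wires). -/
def cubeOpsFin (n : ℕ) (hn : 0 < n + n) : List (ClOp (Fin (n + n))) :=
  (cubeOpsA n).map (ClOp.map (RevSim.finOf (n + n) hn))

/-- The transported program is well formed. -/
theorem cubeOpsFin_wf (n : ℕ) (hn : 0 < n + n) : ∀ op ∈ cubeOpsFin n hn, op.WF := by
  intro op hop
  obtain ⟨op', hop', rfl⟩ := List.mem_map.1 hop
  exact RevSim.wf_map_finOf hn (cubeOpsA_wires op' hop') (cubeOpsA_wf op' hop')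

/-- The gates of the witness circuit on input length `n`: a Hadamard on each input wire, then the
compiled cube program (empty for `n = 0`). -/
def cubeGates (n : ℕ) : List (QGate cliffordT (n + n)) :=
  if hn : 0 < n + n then
    (List.finRange n).map (fun i => hOn (Fin.castAdd n i)) ++
      revCompile (toRevList (cubeOpsFin n hn) (cubeOpsFin_wf n hn))
  else []

/-- The witness circuit on input length `n` (`n` input wires, `n` ancillas). -/
def cubeCirc (n : ℕ) : QCircuit cliffordT (n + n) := ⟨cubeGates n⟩

/-- The Boolean map computed by the cube program into the ancilla register: bit `l` of the ancilla
register after running `cubeOpsA n` on `|y⟩|0ⁿ⟩` (for `n = 2·3^k` these are the coordinates of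
`y³` in `𝔽₂[X]/(Φ_{3^{k+1}})`, proved in the sequel files). -/
def cubeMap (n : ℕ) (y : Fin n → Bool) : Fin n → Bool :=
  fun l => clEval (cubeOpsA n) (RevSim.liftW (padInput y n)) (n + l)

/-- **The witness family of `NoFreeFrame`**: `n` ancillas on inputs of length `n`; on the input
`0ⁿ` its final state is the normalised graph state `2^{-n/2} Σ_y |y⟩|y³⟩` of the cube map of
`𝔽₂[X]/(X^{2h} + X^h + 1)`, `h = n/2` — a field for `n = 2·3^k`. -/
def cubeFamily : QCircuitFamily cliffordT :=
  ⟨fun n => n, cubeCirc⟩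

/-! ### The good input lengths: the fields `𝔽₂[X]/(Φ_{3^{k+1}})` -/

/-- `Φ_{3^{k+1}} = X^{2·3^k} + X^{3^k} + 1 ∈ 𝔽₂[X]`. -/
abbrev cubePoly (k : ℕ) : Polynomial (ZMod 2) := Polynomial.cyclotomic (3 ^ (k + 1)) (ZMod 2)

/-- `deg Φ_{3^{k+1}} = 2·3^k`. -/
theorem natDegree_cubePoly (k : ℕ) : (cubePoly k).natDegree = 2 * 3 ^ k := by
  rw [Polynomial.natDegree_cyclotomic, Nat.totient_prime_pow Nat.prime_three (Nat.succ_pos k)]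
  simp [mul_comm]

/-- The power basis `1, α, …, α^{2·3^k − 1}` of `𝔽₂[X]/(Φ_{3^{k+1}})`, indexed by `Fin (2·3^k)`. -/
def cubeBasis (k : ℕ) : Module.Basis (Fin (2 * 3 ^ k)) (ZMod 2) (AdjoinRoot (cubePoly k)) :=
  ((AdjoinRoot.powerBasis' (Polynomial.cyclotomic.monic _ _)).basis).reindex
    (finCongr (by rw [AdjoinRoot.powerBasis'_dim, natDegree_cubePoly]))

/-- The coordinate identification `e : 𝔽₂[X]/(Φ_{3^{k+1}}) ≃+ 𝔽₂^{2·3^k}` in the power basis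
(additive, i.e. `𝔽₂`-linear, as `CubeGraphFlat` requires). -/
def cubeEquiv (k : ℕ) : AdjoinRoot (cubePoly k) ≃+ (Fin (2 * 3 ^ k) → ZMod 2) :=
  (cubeBasis k).equivFun.toAddEquiv

end Summit.QuantumAdvantage.QuantumAdvantage.Theorems.SymplecticPurity
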